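import Summits.Ventures.YMGap.RobustBall.PeriodisedDLR
import Summits.Ventures.YMGap.RobustBall.RobustAreaLawOnBall
import HarnessLib

/-!
# Venture YMGap, track ROBUST-BALL — the VAN HOVE JOIN, step 4: the periodised family of a member of the
# gauge-invariant `ℤ^d` ball lies in the TORUS ball of record and is slab-local

HONEST FRAMING. WHAT THIS IS: a venture file (cell `pub-ymgap`, track Y2 ROBUST-BALL, seat ds-3): bookkeeping
linking the `ℤ^d` ball `MemBallZdG ε₀ ε₁ R` (ds-2) to the torus balls on which the track's AREA-LAW rows are stated.
For a member `(W, supp)` — continuous gauge-invariant terms reading their own links, locally finite support of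
range `R`, per-link oscillation witnesses with load `≤ ε₀` and site-incidence Lipschitz load `≤ ε₁` — the
PERIODISED FAMILY (`periodisedFamily`, previous file) satisfies, on EVERY torus: (i) membership in the tier-1
torus ball of record `ClusterDomainFR ε₀ ε₁ R` (`periodisedFamily_mem_clusterDomainFR`; ds-2's
`chartMember_mem_clusterDomainFR` fed with the box-family load domination of `PeriodisedBox.lean`); (ii) vertical
dependence diameter `2R + 1` (`hasVertRange_periodisedFamily`: all sets with one code share their base sites by
injectivity of `mod (L+1)` on the box, and an active set has `ℓ^∞` diameter `≤ R`); (iii) hence slab locality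
`IsSlabLocal (2R+1)` as soon as `2R + 1 < L + 1` (rb-p2's `isSlabLocal_of_hasVertRange`, torus dimension `n + 1`),
and (iv) the «eventually in `ClusterDomainFR ε₀ ε₁ R ∩ IsSlabLocal (2R+1)`» hypothesis of every limit-state
area-law theorem of the track (`eventually_periodisedFamily_mem_and_isSlabLocal`). Packaged from `MemBallZdG`:
`MemBallZdG.eventually_periodisedFamily`. WHAT THIS IS NOT: no estimate on a measure; nothing about the continuum
or the Clay Millennium problem.

References: ds-2 `StarChartMember.lean`, `MassGapOnBallZdG.lean`; rb-p2 `RobustAreaLawOnBall.lean`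
(`isSlabLocal_of_hasVertRange`); rb-theory `Defs.lean` (`ClusterDomainFR`, `HasVertRange`, `IsSlabLocal`);
H.-O. Georgii (2011) §1.2.
-/

noncomputable section

open MeasureTheory Filter Topology Function Finset
open Literature.Probability.LatticeModels
open Literature.Probability.LatticeModels.DobrushinMetric
open Literature.MathematicalPhysics.QuantumLattice hiding torusNorm
open Literature.MathematicalPhysics.QuantumFieldTheory hiding ZdEdge Site

namespace Summit.Ventures.YMGap.RobustBall

variable {d N : ℕ} {W : Potential (ZdEdge d) (SUN N)} {supp : Finset (ZdEdge d) → Finset (Finset (ZdEdge d))}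
  {hdep : ∀ X, DependsOn (W X) (↑X : Set (ZdEdge d))} {hg : ∀ X, IsZdGaugeInvariant (W X)}
  {hm : ∀ X, Measurable (W X)} {hb : ∀ X, ∃ C, ∀ U, |W X U| ≤ C}

/-! ### (i) The periodised family lies in the torus ball of record -/

/-- **The periodised family lies in `ClusterDomainFR ε₀ ε₁ R` on every torus**, given local finiteness, the range
condition (listed sets through a link within `ℓ^∞`-distance `R` of it), per-link witnesses `osc`, `lip` of the
terms, oscillation load `≤ ε₀` at every link and site-incidence Lipschitz load `≤ ε₁` at every site (the data of
ds-2's `MemBallZdG ε₀ ε₁ R`): the box family keeps only active sets, whose loads are dominated by the member's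
(`oscLoad_boxFamily_le`, `lipLoad_boxFamily_le`), and `mod (L+1)` is injective on the box. [folklore] -/
theorem periodisedFamily_mem_clusterDomainFR (hsupp : W.IsSupportedBy supp) {R : ℕ}
    (hrange : ∀ e, ∀ X ∈ supp {e}, e ∈ X → ∀ y ∈ X, ‖e.1 - y.1‖ ≤ (R : ℝ))
    {osc lip : Finset (ZdEdge d) → ZdEdge d → ℝ} (hosc : ∀ X, Dobrushin.IsOscBound (W X) (osc X))
    (hlip : ∀ X, IsLipBound suFrobDist (W X) (lip X)) {ε₀ ε₁ : ℝ} (hε₀ : 0 ≤ ε₀) (hε₁ : 0 ≤ ε₁)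
    (h₀ : ∀ e, ∑ X ∈ (supp {e}).filter (fun X => e ∈ X), osc X e ≤ ε₀)
    (h₁ : ∀ v : Site d, ∑ X ∈ listedAt supp v, ∑ y ∈ X, lip X y ≤ ε₁) (L : ℕ) :
    periodisedFamily W supp hdep hg hm hb L ∈ ClusterDomainFR ε₀ ε₁ R :=
  chartMember_mem_clusterDomainFR (injOn_proj_siteBox_half L) boxFamily_base_subset hosc hlip
    (boxFamily_diam_le hsupp hrange) hε₀ hε₁ (oscLoad_boxFamily_le hsupp hosc h₀ (L / 2))
    (lipLoad_boxFamily_le hsupp hlip h₁ (L / 2))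

/-! ### (ii) Vertical dependence diameter of the periodised family -/

/-- Two sets of the box family with the same code have the same base sites (injectivity of `mod L` on the box).
[folklore] -/
theorem base_eq_of_chartCode_eq {L n : ℕ} (hn : 2 * n < L) {X X₀ : Finset (ZdEdge d)}
    (hX : X ∈ boxFamily W supp n) (hX₀ : X₀ ∈ boxFamily W supp n) (hcode : chartCode L X = chartCode L X₀)
    {e : ZdEdge d} (he : e ∈ X) : ∃ e₀ ∈ X₀, e₀.1 = e.1 := by
  have hmem : Torus.proj L e.1 ∈ chartCode L X₀ := hcode ▸ mem_chartCode.2 ⟨e, he, rfl⟩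
  obtain ⟨e₀, he₀, hproj⟩ := mem_chartCode.1 hmem
  exact ⟨e₀, he₀, injOn_proj_siteBox hn (Finset.mem_coe.2 (base_mem_siteBox_of_mem_boxFamily hX₀ he₀))
    (Finset.mem_coe.2 (base_mem_siteBox_of_mem_boxFamily hX he)) hproj⟩

/-- **Vertical dependence diameter `2R + 1` of the chart member of a box family** (`2n < L`): for every code `Y`
and direction `v`, the activity `Σ_{X : code X = Y} W_X ∘ torusLift` reads, among the `v`-links, only those at the
`2R + 1` consecutive heights `x₀ᵥ − R, …, x₀ᵥ + R` around the height of a base site `x₀` of one set of the fibre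
(all sets of the fibre share their base sites; active sets have diameter `≤ R`). [folklore] -/
theorem hasVertRange_chartMember_boxFamily {L : ℕ} [NeZero L] (hsupp : W.IsSupportedBy supp) {R n : ℕ}
    (hn : 2 * n < L) (hrange : ∀ e, ∀ X ∈ supp {e}, e ∈ X → ∀ y ∈ X, ‖e.1 - y.1‖ ≤ (R : ℝ)) :
    HasVertRange (2 * R + 1) (chartMember L (boxFamily W supp n) W hdep hg hm hb) := by
  classical
  intro Y v
  by_cases hY : ∃ X₀ ∈ chartFiber L (boxFamily W supp n) Y, X₀.Nonempty
  · obtain ⟨X₀, hX₀, ⟨e₀, he₀⟩⟩ := hY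
    obtain ⟨hX₀S, hX₀code⟩ := mem_chartFiber.1 hX₀
    refine ⟨((e₀.1 v - R : ℤ) : ZMod L), fun U U' hUU' => ?_⟩
    simp only [chartMember_act]
    refine Finset.sum_congr rfl fun X hX => hdep X fun e he => ?_
    obtain ⟨hXS, hXcode⟩ := mem_chartFiber.1 hX
    have heX : e ∈ X := Finset.mem_coe.1 he
    refine hUU' (torusEdge L e) ?_
    by_cases hv : e.2 = v
    · -- the height of `e` is within `R` of the height of `e₀`
      obtain ⟨e₁, he₁, he₁e⟩ := base_eq_of_chartCode_eq hn hXS hX₀S (hXcode.trans hX₀code.symm) heX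
      have hdist : ‖e₀.1 - e₁.1‖ ≤ R := boxFamily_diam_le hsupp hrange X₀ hX₀S e₀ he₀ e₁ he₁
      have hcoord : |e₀.1 v - e.1 v| ≤ R := by
        have h1 : ‖(e₀.1 - e₁.1) v‖ ≤ R := (norm_le_pi_norm _ v).trans hdist
        rw [Pi.sub_apply, he₁e, Int.norm_eq_abs, ← Int.cast_abs] at h1
        exact_mod_cast h1
      refine Or.inr ⟨(e.1 v - (e₀.1 v - R)).toNat, ?_, ?_⟩
      · have : e.1 v - (e₀.1 v - R) ≤ 2 * R := by rw [abs_le] at hcoord; linarith [hcoord.1]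
        omega
      · have h0 : 0 ≤ e.1 v - (e₀.1 v - R) := by rw [abs_le] at hcoord; linarith [hcoord.2]
        show ((e.1 v : ℤ) : ZMod L) = ((e₀.1 v - R : ℤ) : ZMod L) + (((e.1 v - (e₀.1 v - R)).toNat : ℕ) : ZMod L)
        rw [show (((e.1 v - (e₀.1 v - R)).toNat : ℕ) : ZMod L) = (((e.1 v - (e₀.1 v - R)).toNat : ℤ) : ZMod L) by
          push_cast; rfl, Int.toNat_of_nonneg h0]
        push_cast
        ring
    · exact Or.inl hv
  · -- every set of the fibre is empty: the activity is constant
    refine ⟨0, fun U U' _ => ?_⟩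
    simp only [chartMember_act]
    refine Finset.sum_congr rfl fun X hX => hdep X fun e he => ?_
    exact absurd ⟨X, hX, ⟨e, Finset.mem_coe.1 he⟩⟩ hY

/-- **Vertical dependence diameter of the periodised family**: `HasVertRange (2R + 1)` on every torus. [folklore] -/
theorem hasVertRange_periodisedFamily (hsupp : W.IsSupportedBy supp) {R : ℕ}
    (hrange : ∀ e, ∀ X ∈ supp {e}, e ∈ X → ∀ y ∈ X, ‖e.1 - y.1‖ ≤ (R : ℝ)) (L : ℕ) :
    HasVertRange (2 * R + 1) (periodisedFamily W supp hdep hg hm hb L) :=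
  hasVertRange_chartMember_boxFamily hsupp (by omega) hrange

/-! ### (iii) Slab locality and (iv) the «eventually in the ball ∩ slab-local» hypothesis -/

section Slab

variable {n N' : ℕ} {W : Potential (ZdEdge (n + 1)) (SUN N')}
  {supp : Finset (ZdEdge (n + 1)) → Finset (Finset (ZdEdge (n + 1)))}
  {hdep : ∀ X, DependsOn (W X) (↑X : Set (ZdEdge (n + 1)))} {hg : ∀ X, IsZdGaugeInvariant (W X)}
  {hm : ∀ X, Measurable (W X)} {hb : ∀ X, ∃ C, ∀ U, |W X U| ≤ C}

/-- **Slab locality of the periodised family** (torus dimension `n + 1`): `IsSlabLocal (2R+1)` on every torus of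
side `L + 1 > 2R + 1` (rb-p2's `isSlabLocal_of_hasVertRange`: centre-slab invariance from vertical range and
per-activity gauge invariance). [folklore] -/
theorem isSlabLocal_periodisedFamily (hsupp : W.IsSupportedBy supp) {R : ℕ}
    (hrange : ∀ e, ∀ X ∈ supp {e}, e ∈ X → ∀ y ∈ X, ‖e.1 - y.1‖ ≤ (R : ℝ)) {L : ℕ} (hL : 2 * R + 1 < L + 1) :
    IsSlabLocal (2 * R + 1) (periodisedFamily W supp hdep hg hm hb L) :=
  isSlabLocal_of_hasVertRange hL (hasVertRange_periodisedFamily hsupp hrange L)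

/-- **The periodised family is, for all large tori, in `ClusterDomainFR ε₀ ε₁ R ∩ IsSlabLocal (2R+1)`** — the
hypothesis of the track's limit-state area-law theorems (`hasAreaLawWith_onBall`, `stringTension_onBall`, …).
[folklore] -/
theorem eventually_periodisedFamily_mem_and_isSlabLocal (hsupp : W.IsSupportedBy supp) {R : ℕ}
    (hrange : ∀ e, ∀ X ∈ supp {e}, e ∈ X → ∀ y ∈ X, ‖e.1 - y.1‖ ≤ (R : ℝ))
    {osc lip : Finset (ZdEdge (n + 1)) → ZdEdge (n + 1) → ℝ} (hosc : ∀ X, Dobrushin.IsOscBound (W X) (osc X))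
    (hlip : ∀ X, IsLipBound suFrobDist (W X) (lip X)) {ε₀ ε₁ : ℝ} (hε₀ : 0 ≤ ε₀) (hε₁ : 0 ≤ ε₁)
    (h₀ : ∀ e, ∑ X ∈ (supp {e}).filter (fun X => e ∈ X), osc X e ≤ ε₀)
    (h₁ : ∀ v : Site (n + 1), ∑ X ∈ listedAt supp v, ∑ y ∈ X, lip X y ≤ ε₁) :
    ∀ᶠ L : ℕ in atTop, periodisedFamily W supp hdep hg hm hb L ∈ ClusterDomainFR ε₀ ε₁ R ∧
      IsSlabLocal (2 * R + 1) (periodisedFamily W supp hdep hg hm hb L) := by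
  filter_upwards [eventually_gt_atTop (2 * R + 1)] with L hL
  exact ⟨periodisedFamily_mem_clusterDomainFR hsupp hrange hosc hlip hε₀ hε₁ h₀ h₁ L,
    isSlabLocal_periodisedFamily hsupp hrange (by omega)⟩

/-- **From `MemBallZdG`**: the periodised family of a member of the gauge-invariant `ℤ^{n+1}` ball
`MemBallZdG ε₀ ε₁ R` (nonnegative radii) is, for all large tori, in `ClusterDomainFR ε₀ ε₁ R ∩ IsSlabLocal (2R+1)`.
The proof terms `hdep hg hm hb` of the family are the member's fields (and boundedness from continuity). [folklore] -/
theorem MemBallZdG.eventually_periodisedFamily {ε₀ ε₁ : ℝ} {R : ℕ} (hmem : MemBallZdG ε₀ ε₁ R W supp)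
    (hε₀ : 0 ≤ ε₀) (hε₁ : 0 ≤ ε₁) (hdep : ∀ X, DependsOn (W X) (↑X : Set (ZdEdge (n + 1))))
    (hg : ∀ X, IsZdGaugeInvariant (W X)) (hm : ∀ X, Measurable (W X)) (hb : ∀ X, ∃ C, ∀ U, |W X U| ≤ C) :
    ∀ᶠ L : ℕ in atTop, periodisedFamily W supp hdep hg hm hb L ∈ ClusterDomainFR ε₀ ε₁ R ∧
      IsSlabLocal (2 * R + 1) (periodisedFamily W supp hdep hg hm hb L) := by
  obtain ⟨osc, lip, hosc, hlip, h₀, h₁⟩ := hmem.loads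
  exact eventually_periodisedFamily_mem_and_isSlabLocal hmem.supportedBy hmem.range hosc hlip hε₀ hε₁ h₀ h₁

end Slab

end Summit.Ventures.YMGap.RobustBall

end
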